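import Literature.Probability.RandomPlanarGeometry.HexSAWStripBetaLengthWidthTwo
import HarnessLib

/-!
# The corner `(x_c, y_2)` of the width-two strip: ONE joint residue `B₂(x; y)·det(I − M_x(y)) → (2 + 45√2)/56`, of which the contact residue
# `(233 + 185√2)/98` and the length residue `(19 − 6√2)/8` are the two directional quotients (module «WIDTH-TWO-CORNER-RESIDUE»)

Topic `Literature/Probability/RandomPlanarGeometry` (continues «BETA-LENGTH-WIDTH-TWO» `HexSAWStripBetaLengthWidthTwo.lean` — `W2.limB2gen`,
`W2.limB2gen_eq_rat`, `W2.kLen`, `W2.lenReg_one`; «BETA-COEFF-WIDTH-TWO» #551 — `HV.wdet_xc_eq` (`det(I − M_{x_c}(y)) = κ₂(y₂ − y)`), `HV.kTwo`,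
`HV.widthTwo_values`, `HV.regB2_yTwo_eq`).  Lane «pcv-sawmu», a-p2 g22 — a rider on cars 3–4 of the «β-walks by length» programme.  Sources of the SETTING:
N. R. Beaton et al., CMP 326 (2014) §3.2, Corollary 8; N. R. Beaton, A. J. Guttmann, I. Jensen, J. Phys. A 45 (2012) §2.  The numbers are the lane's.

## What is proved (namespace `Literature.Probability.RandomPlanarGeometry.SAW.HV.W2`)

* `cornerNum x y := 2x⁴y(2 − 4x⁴y + 2x⁶y + 2x⁸y² − x¹⁰y²)/(1 − x⁴y)²` (the regular factor of `B₂`), `limB2gen_mul_wdet_eq` (`B₂·det = cornerNum` off the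
  zero set of `det`), `continuousAt_cornerNum`, ★ `cornerNum_corner : cornerNum x_c y₂ = (2 + 45√2)/56`;
* ★★ `tendsto_limB2gen_mul_wdet_corner` — `B₂(x; y)·det(I − M_x(y)) ⟶ (2 + 45√2)/56` as `(x, y) → (x_c, y₂)` through points with `det ≠ 0`;
* ★ `cornerResidue_directional` — `(2 + 45√2)/56 = κ₂ · (233 + 185√2)/98 = k(1) · (19 − 6√2)/8` with `κ₂ = (8 − 5√2)/4` (the `y`-slope of `det` at the
  corner, #551) and `k(1) = (2 + 3√2)/7` (the `s²`-slope along the length ray, car 3): the contact residue of #551 and the length residue of car 3 are the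
  two directional quotients of ONE corner residue.

Label: LANE COROLLARY (own, a-p2 g22, 2026-08-26).  NOT claimed: anything beyond width two.
-/

noncomputable section

open Filter Topology

namespace Literature.Probability.RandomPlanarGeometry.SAW.HV

namespace W2

variable {x y : ℝ}

/-- The regular factor of `B₂(x; y)`: `cornerNum x y := 2x⁴y(2 − 4x⁴y + 2x⁶y + 2x⁸y² − x¹⁰y²)/(1 − x⁴y)²` (plumbing).
[cite: BeatonGuttmannJensen2012, §2; lane plumbing] -/
def cornerNum (x y : ℝ) : ℝ :=
  2 * x ^ 4 * y * (2 - 4 * x ^ 4 * y + 2 * x ^ 6 * y + 2 * x ^ 8 * y ^ 2 - x ^ 10 * y ^ 2) / (1 - x ^ 4 * y) ^ 2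

/-- `B₂(x; y) · det(I − M_x(y)) = cornerNum x y` wherever `det ≠ 0` and `x⁴y ≠ 1`. [cite: BeatonGuttmannJensen2012, §2; lane plumbing] -/
theorem limB2gen_mul_wdet_eq (hdet : wdet x y ≠ 0) (h4 : 1 - x ^ 4 * y ≠ 0) : limB2gen x y * wdet x y = cornerNum x y := by
  rw [limB2gen_eq_rat hdet h4, cornerNum]
  field_simp

/-- `cornerNum` is continuous at the corner (its denominator `(1 − x_c⁴y₂)² ≠ 0`). [cite: BeatonBousquetMelouDeGierDuminilCopinGuttmann2014, Corollary 8 (arXiv v5 p. 12); lane plumbing] -/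
theorem continuousAt_cornerNum : ContinuousAt (fun p : ℝ × ℝ => cornerNum p.1 p.2) (hexCriticalFugacity, yTwo) := by
  have h4 : (1 - hexCriticalFugacity ^ 4 * yTwo) ^ 2 ≠ 0 := pow_ne_zero 2 (sub_pos.2 (xc_four_mul_lt_one le_rfl)).ne'
  unfold cornerNum
  refine ContinuousAt.div ?_ ?_ h4 <;> fun_prop

/-- ★ **The value at the corner**: `cornerNum x_c y₂ = (2 + 45√2)/56 = 1.17213…`. [cite: DuminilCopinSmirnov2012, Theorem 1 (x_c); BeatonBousquetMelouDeGierDuminilCopinGuttmann2014, Corollary 8; lane «pcv-sawmu» a-p2 g22 — own] -/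
theorem cornerNum_corner : cornerNum hexCriticalFugacity yTwo = (2 + 45 * Real.sqrt 2) / 56 := by
  have hr : Real.sqrt 2 ^ 2 = 2 := Real.sq_sqrt (by norm_num)
  obtain ⟨hay, hu, -, -⟩ := widthTwo_values
  have ha := xc_sq_eq_half
  have key : cornerNum hexCriticalFugacity yTwo = 2 * (hexCriticalFugacity ^ 4 * yTwo) *
      (2 - 4 * (hexCriticalFugacity ^ 4 * yTwo) + 2 * hexCriticalFugacity ^ 2 * (hexCriticalFugacity ^ 4 * yTwo) +
        2 * (hexCriticalFugacity ^ 4 * yTwo) ^ 2 - hexCriticalFugacity ^ 2 * (hexCriticalFugacity ^ 4 * yTwo) ^ 2) /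
      (1 - hexCriticalFugacity ^ 4 * yTwo) ^ 2 := by
    unfold cornerNum; ring
  rw [key, hu, ha]
  have hden : (1 - (2 * Real.sqrt 2 - 1) / 7) ^ 2 ≠ 0 := by
    have h1 : 0 < 1 - (2 * Real.sqrt 2 - 1) / 7 := by nlinarith [Real.sqrt_nonneg 2, hr]
    positivity
  rw [div_eq_iff hden]
  linear_combination ((121 / 343 : ℝ) - (149 / 686 : ℝ) * Real.sqrt 2 + (8 / 343 : ℝ) * Real.sqrt 2 ^ 2) * hr

/-- ★★ **ONE JOINT RESIDUE AT THE CORNER**: `B₂(x; y) · det(I − M_x(y)) ⟶ (2 + 45√2)/56` as `(x, y) → (x_c, y₂)` through points where the determinant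
does not vanish and `x⁴y ≠ 1` (in particular through the punctured rectangle `[0, x_c] × [0, y₂] ∖ {(x_c, y₂)}`).
[cite: BeatonBousquetMelouDeGierDuminilCopinGuttmann2014, §3.2 and Corollary 8 (arXiv v5 p. 12); BeatonGuttmannJensen2012, §2; lane «pcv-sawmu» a-p2 g22 — own] -/
theorem tendsto_limB2gen_mul_wdet_corner :
    Tendsto (fun p : ℝ × ℝ => limB2gen p.1 p.2 * wdet p.1 p.2)
      (𝓝[{p : ℝ × ℝ | wdet p.1 p.2 ≠ 0 ∧ 1 - p.1 ^ 4 * p.2 ≠ 0}] (hexCriticalFugacity, yTwo)) (𝓝 ((2 + 45 * Real.sqrt 2) / 56)) := by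
  rw [← cornerNum_corner]
  have hc := (continuousAt_cornerNum.tendsto).mono_left
    (nhdsWithin_le_nhds (s := {p : ℝ × ℝ | wdet p.1 p.2 ≠ 0 ∧ 1 - p.1 ^ 4 * p.2 ≠ 0}))
  refine hc.congr' ?_
  filter_upwards [self_mem_nhdsWithin] with p hp
  exact (limB2gen_mul_wdet_eq hp.1 hp.2).symm

/-- ★ **The two known residues are the directional quotients of the corner residue**: `(2 + 45√2)/56 = κ₂ · (233 + 185√2)/98` (`κ₂ = (8 − 5√2)/4`, the
`y`-slope of the determinant at `x = x_c`: the CONTACT residue of #551) `= k(1) · (19 − 6√2)/8` (`k(1) = (2 + 3√2)/7`, the slope in `s²` along the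
threshold ray: the LENGTH residue of «BETA-LENGTH-WIDTH-TWO»). [cite: BeatonBousquetMelouDeGierDuminilCopinGuttmann2014, Corollary 8; lane «pcv-sawmu» a-p2 g21/g22 — own] -/
theorem cornerResidue_directional :
    (2 + 45 * Real.sqrt 2) / 56 = (8 - 5 * Real.sqrt 2) / 4 * ((233 + 185 * Real.sqrt 2) / 98) ∧
      (2 + 45 * Real.sqrt 2) / 56 = (2 + 3 * Real.sqrt 2) / 7 * ((19 - 6 * Real.sqrt 2) / 8) ∧
      kTwo = (8 - 5 * Real.sqrt 2) / 4 ∧ kLen 1 = (2 + 3 * Real.sqrt 2) / 7 := by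
  have hr : Real.sqrt 2 ^ 2 = 2 := Real.sq_sqrt (by norm_num)
  obtain ⟨hay, hu, -, hκ⟩ := widthTwo_values
  have ha := xc_sq_eq_half
  refine ⟨by linear_combination (925 / 392 : ℝ) * hr, by linear_combination (18 / 56 : ℝ) * hr, hκ, ?_⟩
  have key : kLen 1 = 2 - hexCriticalFugacity ^ 2 - hexCriticalFugacity ^ 2 * yTwo +
      hexCriticalFugacity ^ 2 * (hexCriticalFugacity ^ 4 * yTwo) := by
    unfold kLen; ring
  rw [key, hu, hay, ha]
  linear_combination (-1 / 7 : ℝ) * hr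

end W2

end Literature.Probability.RandomPlanarGeometry.SAW.HV
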